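import Mathlib.Analysis.Calculus.Deriv.Abs
import Mathlib.Analysis.SpecialFunctions.SmoothTransition
import Literature.NumberTheory.Transcendental.KZLogCalculusProofs
import Literature.NumberTheory.Transcendental.KZIntervalPeriodProofs

/-!
# Crux `LiouvilleUnfolding.LogPrimitiveNL` (stmt-KontsevichZagierPeriods-2836), line `ax-schanuel-germs`:
# load-bearing hypotheses of the FLATNESS clause of `stub_oneVarSemialgebraic` (drefute, gen 3)

The second conjunct of the engine stub `stub_oneVarSemialgebraic` of
`Cruxes/LogPrimitiveNL/Lines/ax-schanuel-germs.lean` (skeleton sha `5e868fb7…`) says: a function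
`φ : ℝ → ℝ` which is real-semialgebraic and `C^∞` on `(-ε, ε)` and FLAT at `0`
(`∀ n, iteratedDeriv n φ 0 = 0`) vanishes near `0`. It is restated verbatim as `OneVarFlatness`, and both
of its structural hypotheses are shown to be load-bearing:

* `not_oneVarFlatnessWithoutContDiff` — witness `φ = |·|`: semialgebraic, and FLAT AS TYPED because
  Mathlib's `iteratedDeriv` takes junk values (`deriv |·| = sign`, `deriv sign = 0` everywhere, the
  value at the jump being the junk `0`), yet `|t| ≠ 0` for `t ≠ 0`. Moral for the lead: the flatness
  hypothesis is only the intended one in presence of `ContDiffOn ℝ ∞ φ (Ioo (-ε) ε)`; do not weaken the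
  smoothness to `C^k` or to differentiability at `0` when reshaping.
* `not_oneVarFlatnessWithoutSemialgebraic` — witness `φ = expNegInvGlue` (`e^{-1/t}` for `t > 0`, `0`
  for `t ≤ 0`): `C^∞`, flat at `0`, positive on `(0, ∞)`.
-/

noncomputable section

open Set Filter
open scoped ContDiff Topology
open Literature.NumberTheory.Transcendental Literature.ModelTheory.ExponentialFields

namespace Summit.KontsevichZagierPeriods.LiouvilleUnfolding.LogPrimitiveNL.Negative

/-! ## §0 Toolkit -/

/-- The interval `(-1, 1)`, as a subset of `ℝ¹`, is real-semialgebraic. -/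
theorem isSemialgebraic_Ioo_fin_one :
    IsSemialgebraic ℝ {x : Fin 1 → ℝ | x 0 ∈ Ioo (-1 : ℝ) 1} := by
  have h1 := isSemialgebraic_setOf_eval_lt (k := ℝ) (R := ℝ) (ι := Fin 1)
    (MvPolynomial.C (-1)) (MvPolynomial.X 0)
  have h2 := isSemialgebraic_setOf_eval_lt (k := ℝ) (R := ℝ) (ι := Fin 1)
    (MvPolynomial.X 0) (MvPolynomial.C 1)
  have hset : {x : Fin 1 → ℝ | x 0 ∈ Ioo (-1 : ℝ) 1} =
      {x : Fin 1 → ℝ | MvPolynomial.aeval x (MvPolynomial.C (-1 : ℝ) : MvPolynomial (Fin 1) ℝ) <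
          MvPolynomial.aeval x (MvPolynomial.X 0 : MvPolynomial (Fin 1) ℝ)} ∩
      {x : Fin 1 → ℝ | MvPolynomial.aeval x (MvPolynomial.X 0 : MvPolynomial (Fin 1) ℝ) <
          MvPolynomial.aeval x (MvPolynomial.C (1 : ℝ) : MvPolynomial (Fin 1) ℝ)} := by
    ext x
    simp
  rw [hset]
  exact h1.inter h2

/-- An `∀ᶠ t in 𝓝 0, φ t = 0` statement yields a positive point where `φ` vanishes. -/
theorem exists_pos_eq_zero_of_eventually {φ : ℝ → ℝ} (h : ∀ᶠ t in 𝓝 (0 : ℝ), φ t = 0) :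
    ∃ t : ℝ, 0 < t ∧ φ t = 0 := by
  obtain ⟨δ, hδ, hh⟩ := Metric.eventually_nhds_iff.mp h
  refine ⟨δ / 2, by positivity, hh ?_⟩
  rw [Real.dist_eq, sub_zero, abs_of_pos (by positivity)]
  linarith

/-- `deriv sign = 0` identically (away from `0` the function is locally constant; at `0` it is not
differentiable — not even continuous — and Mathlib's `deriv` returns the junk value `0`). -/
theorem deriv_sign_cast_eq_zero :
    deriv (fun t : ℝ => ((SignType.sign t : SignType) : ℝ)) = fun _ => 0 := by
  funext x
  rcases lt_trichotomy x 0 with hx | rfl | hx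
  · have h : (fun t : ℝ => ((SignType.sign t : SignType) : ℝ)) =ᶠ[𝓝 x] fun _ => (-1 : ℝ) := by
      filter_upwards [Iio_mem_nhds hx] with t ht
      rw [sign_neg (mem_Iio.mp ht)]
      simp
    rw [h.deriv_eq, deriv_const]
  · refine deriv_zero_of_not_differentiableAt fun hd => ?_
    have hc : ContinuousAt (fun t : ℝ => ((SignType.sign t : SignType) : ℝ)) 0 := hd.continuousAt
    have h1 : Tendsto (fun t : ℝ => ((SignType.sign t : SignType) : ℝ)) (𝓝[>] 0) (𝓝 1) := by
      refine (tendsto_const_nhds (x := (1 : ℝ))).congr' ?_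
      filter_upwards [self_mem_nhdsWithin] with t ht
      rw [sign_pos (mem_Ioi.mp ht)]
      simp
    have h2 : Tendsto (fun t : ℝ => ((SignType.sign t : SignType) : ℝ)) (𝓝[>] 0) (𝓝 0) := by
      have := hc.tendsto.mono_left (nhdsWithin_le_nhds (s := Ioi (0 : ℝ)))
      simpa using this
    have := tendsto_nhds_unique h1 h2
    exact one_ne_zero this
  · have h : (fun t : ℝ => ((SignType.sign t : SignType) : ℝ)) =ᶠ[𝓝 x] fun _ => (1 : ℝ) := by
      filter_upwards [Ioi_mem_nhds hx] with t ht
      rw [sign_pos (mem_Ioi.mp ht)]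
      simp
    rw [h.deriv_eq, deriv_const]

/-- **`|·|` is flat at `0` in the sense of Mathlib's `iteratedDeriv`** (junk values at the kink). -/
theorem iteratedDeriv_abs_zero (n : ℕ) : iteratedDeriv n (fun t : ℝ => |t|) 0 = 0 := by
  rcases n with _ | n
  · simp
  · rw [iteratedDeriv_succ', show deriv (fun t : ℝ => |t|) =
        fun t => ((SignType.sign t : SignType) : ℝ) from funext deriv_abs]
    rcases n with _ | n
    · simp
    · rw [iteratedDeriv_succ', deriv_sign_cast_eq_zero]
      simp

/-- **`expNegInvGlue` is flat at `0`.** -/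
theorem iteratedDeriv_expNegInvGlue_zero (n : ℕ) : iteratedDeriv n expNegInvGlue 0 = 0 := by
  have hcont : Continuous (iteratedDeriv n expNegInvGlue) :=
    (expNegInvGlue.contDiff (n := n)).continuous_iteratedDeriv' n
  have hleft : ∀ x : ℝ, x < 0 → iteratedDeriv n expNegInvGlue x = 0 := by
    intro x hx
    have h : expNegInvGlue =ᶠ[𝓝 x] fun _ => (0 : ℝ) := by
      filter_upwards [Iio_mem_nhds hx] with t ht
      exact expNegInvGlue.zero_of_nonpos (mem_Iio.mp ht).le
    rw [h.iteratedDeriv_eq n]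
    simp
  have h1 : Tendsto (iteratedDeriv n expNegInvGlue) (𝓝[<] 0) (𝓝 0) := by
    refine (tendsto_const_nhds (x := (0 : ℝ))).congr' ?_
    filter_upwards [self_mem_nhdsWithin] with t ht
    exact (hleft t (mem_Iio.mp ht)).symm
  have h2 : Tendsto (iteratedDeriv n expNegInvGlue) (𝓝[<] 0)
      (𝓝 (iteratedDeriv n expNegInvGlue 0)) :=
    (hcont.tendsto 0).mono_left nhdsWithin_le_nhds
  exact tendsto_nhds_unique h2 h1

/-! ## §1 The flatness clause and its two mutations -/

/-- Conjunct (2) of `stub_oneVarSemialgebraic` of the skeleton, verbatim. -/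
def OneVarFlatness : Prop :=
  ∀ (φ : ℝ → ℝ) (ε : ℝ), 0 < ε →
    IsSemialgebraicFunOn ℝ {x : Fin 1 → ℝ | x 0 ∈ Ioo (-ε) ε} (fun x => φ (x 0)) →
      ContDiffOn ℝ ∞ φ (Ioo (-ε) ε) → (∀ n : ℕ, iteratedDeriv n φ 0 = 0) →
        ∀ᶠ t in 𝓝 (0 : ℝ), φ t = 0

/-- The flatness clause with the smoothness hypothesis dropped. -/
def OneVarFlatnessWithoutContDiff : Prop :=
  ∀ (φ : ℝ → ℝ) (ε : ℝ), 0 < ε →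
    IsSemialgebraicFunOn ℝ {x : Fin 1 → ℝ | x 0 ∈ Ioo (-ε) ε} (fun x => φ (x 0)) →
      (∀ n : ℕ, iteratedDeriv n φ 0 = 0) →
        ∀ᶠ t in 𝓝 (0 : ℝ), φ t = 0

/-- **Smoothness is load-bearing** (as typed, through the junk values of `iteratedDeriv`):
`φ = |·|` on `(-1, 1)`. -/
theorem not_oneVarFlatnessWithoutContDiff : ¬ OneVarFlatnessWithoutContDiff := by
  intro H
  have hsa : IsSemialgebraicFunOn ℝ {x : Fin 1 → ℝ | x 0 ∈ Ioo (-1 : ℝ) 1}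
      (fun x => |x 0|) :=
    (isSemialgebraicFunOn_apply isSemialgebraic_Ioo_fin_one 0).abs
  obtain ⟨t, ht, h0⟩ := exists_pos_eq_zero_of_eventually
    (H (fun t => |t|) 1 one_pos hsa iteratedDeriv_abs_zero)
  exact ht.ne' (abs_eq_zero.mp h0)

/-- The flatness clause with the semialgebraicity hypothesis dropped. -/
def OneVarFlatnessWithoutSemialgebraic : Prop :=
  ∀ (φ : ℝ → ℝ) (ε : ℝ), 0 < ε →
      ContDiffOn ℝ ∞ φ (Ioo (-ε) ε) → (∀ n : ℕ, iteratedDeriv n φ 0 = 0) →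
        ∀ᶠ t in 𝓝 (0 : ℝ), φ t = 0

/-- **Semialgebraicity is load-bearing**: `φ = expNegInvGlue` is `C^∞`, flat at `0` and positive on
`(0, ∞)`. -/
theorem not_oneVarFlatnessWithoutSemialgebraic : ¬ OneVarFlatnessWithoutSemialgebraic := by
  intro H
  obtain ⟨t, ht, h0⟩ := exists_pos_eq_zero_of_eventually
    (H expNegInvGlue 1 one_pos (expNegInvGlue.contDiff.contDiffOn) iteratedDeriv_expNegInvGlue_zero)
  exact (expNegInvGlue.pos_of_pos ht).ne' h0

end Summit.KontsevichZagierPeriods.LiouvilleUnfolding.LogPrimitiveNL.Negative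

end
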